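import Literature.MathematicalPhysics.QuantumFieldTheory.Balaban1983to89.B8Ineq192MultiLevelTorusP22
import Literature.MathematicalPhysics.QuantumFieldTheory.Balaban1983to89.B8Ineq198MultiLevelTorusP22
import Literature.MathematicalPhysics.QuantumFieldTheory.Balaban1983to89.B6Prop23MultiLevelTorus

/-!
# `Balaban1983to89.B8Ineq192MultiLevelTorusP23` — T. Bałaban, *Spaces of regular gauge field configurations on a lattice and
# gauge fixing conditions*, Commun. Math. Phys. **99** (1985) 75–102 [Balaban1985RegularSpaces], **(1.91)–(1.92)** p. 91, the
# p. 93 Δ-entry, «Q′H′ = I» (p. 96) and p. 92 «|Rf| ≦ B′₀|f|» **AT U₀ = 1 ON PRINT'S CARRIER — THE GENUINE `k`-LEVEL NESTED-DOMAIN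
# TORUS FAMILY `T_η = Ω₁ ⊃ … ⊃ Ω_k` — HYPOTHESIS-FREE**: the argument `G` of `B8Ineq192MultiLevelTorus` /
# `B8Ineq192MultiLevelTorusP22` instantiated with THE inverse `(Q′G′²Q′*)⁻¹ = GinvT D a` of [B6] Proposition 2.3 for this family
# (`B6Prop23MultiLevelTorus.prop23_multiLevelTorus`, seat p21 gen 16, p350221, 2026-08-23T02:58Z)

statement-level skeleton of published theorems with citation tags; proofs where landed; nothing here is a claim about the Yang–Mills mass gap

CITATION HEADER (lean-in-tree rule).  Cell `lit-balaban`, unit `lit-balaban-r05` gen 59 (B8 reader/typer and fold owner; the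
announced successor step of `B8Ineq192MultiLevelTorus` p342575 / `B8Ineq192MultiLevelTorusP22` p344413, HOME/lit-balaban-r05/HANDOFF.md
§ gen 54–58 trigger (iii-c); torus twin of `B8Ineq192MultiLevelBoxP23` p335269).  WHAT IS REPRODUCED = SKELETON rows **B8.Eq1.91**
(member (1.92) + the p. 93 Δ-entry + «Q′H′ = I») and **B8.Claim@92** («|Rf| ≦ B′₀|f|») at the flat background ON PRINT'S OWN CARRIER
`T_η`, NOW WITH NO HYPOTHESIS: `B8Ineq192MultiLevelTorus` proved the kernel decay of `H′ = G′²Q′*G`, (1.92) and «|Rf| ≦ B′₀|f|» for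
EVERY operator `G` on `𝔅` carrying the printed (2.87)-bound of `(Q′G′²Q′*)⁻¹` and for the three [B6] Prop.-2.2 majorants of `G′`;
`B8Ineq192MultiLevelTorusP22` / `B8Ineq198MultiLevelTorusP22.prop22_entries1236_multiLevelTorus` discharged the Prop.-2.2 majorants by
p21's torus Proposition 2.2 (T4–T7); p21's `B6Prop23MultiLevelTorus.prop23_multiLevelTorus` (G2 of the torus `(Q′G′²Q′*)⁻¹` programme)
now supplies, for every member of the family, THE operator `GinvT D a` WITH A BODY, with `GinvT·(Q′G′²Q′*) = 1`, `(Q′G′²Q′*)·GinvT = 1`,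
uniqueness, and (2.87) in exactly the letters consumed here (`kerOp (W D.toDomains) (XkT D a)`, `(geomT D).len`, `(geomT D).dist`).
This file is the three-line composition: on every nested torus family and all windowed weights, `H′ = G′²Q′*(Q′G′²Q′*)⁻¹`
(`hPrimeMLT D a (GinvT D a)`) and `R = 1 − G′Q′*(Q′G′²Q′*)⁻¹Q′G′` (`rProjMLT D a (GinvT D a)`) — print's operators (1.91) and (1.27)/(3.25)
themselves at U₀ = 1, no operator argument left — obey the kernel decay, (1.92), the Δ-entry, «Q′H′ = I», the projection identities
and «|Rf| ≦ B′₀|f|», with constants depending on `d, ℓ` and the weight windows only.  Kind «kernel-checked proof of a model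
instance»; theorems only; every input BY NAME; 0 sorry; no fact minted.

WHAT IS PRINTED (verbatim, held text `paper:balaban1985-cmp99-regular-spaces-gauge-fixing`).  p. 91 [p0017 L30–33]: *"Let us
introduce the operators H′ = G′²Q′\*(Q′G′²Q′\*)⁻¹, G′ = (Δ + Q′\*aQ′)⁻¹. (1.91) They were investigated in [4], and the following
inequality can be obtained from the results of this paper: |(H′X)(x)|, |(∇H′X)(x)| ≦ B′₀[1, (Lʲη)⁻¹]|X| for x ∈ Ω_j, (1.92)"*;
p. 92 [p0018 L2–4]: *"where (H′X)(x) = Σ_{y′∈𝔅_k}(L^{j′}η)^d H′(x, y′)X(y′), and B′₀ is an absolute constant (depending on d and L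
only)."*; p. 92 [p0018 L16–17]: *"Let us recall that from Theorems 3.1, 3.2 of [4] it follows that |Rf| ≦ B′₀|f|"*; p. 93 [p0019 L3]
«… and with ΔH′D′(u₁, λ)» (the Δ-entry consumed in (1.99)); p. 96 (1.115) ⇒ (1.116) («Q′H′ = I»).  [B6] CMP **96**
[Balaban1984PropagatorsII] p. 235 [p0013 L19–20]: *"Of course the operator Q′G′²Q′\* is positive definite, so its inverse is well
defined."*; Proposition 2.3 p. 238 [p0016 L13–18]: *"An inverse of the operator Q′G′²Q′\* is given by the convergent expansion … (2.86)
and it satisfies the estimate |(Q′G′²Q′\*)⁻¹(y, y′)| ≦ O(1)(Lʲη)⁻⁴(L^{j′}η)^{−d}e^{−½δ₁d(y,y′)}, y ∈ Λ_j, y′ ∈ Λ_{j′}. (2.87)"*;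
p. 224 «we admit the case when some domains Ω_j are equal to T_η».

HONEST SCOPE / NOT CLAIMED.  As `B8Ineq192MultiLevelTorus(P22)`: print's carrier `T_η` with `Ω₁ = T_η` (levels `1 … k`), `A = 0`
(U₀ = 1), scalar fibre, lattice units (η = 1, lengths `Lʲ`), `∇_μ = dT N₀ μ` (p21's periodic forward difference), `−Δ_T = perLapT N₀`,
`x ∈ Ω_j` read at the point's own level `j = D.lev x`; constants existential (functions of `d, ℓ` and the windows; print: «depending
on d and L only» at the series' fixed `a`); thresholds «M, RM sufficiently large» explicit (`M_h ≥ 3`, `L·M_h ≥ M₀`, `R ≥ 2L`,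
`R·L·M_h ≥ N₀ + 1`, torus periods `P_μ ≥ 4` of p21's charts); p21's (2.87) is obtained by its own route (global (2.78)_T + [3] Sect. 5,
not the expansion (2.86)) — immaterial here, only the statement (2.87) is consumed.  The general (1.92) / «|Rf| ≦ B′₀|f|» at a
background `U₀ ∈ 𝔄_k` ([4] Thms 3.1–3.3) stays the typed leaf of `B8Ineq192` / `B8Ineq192Op`; rows B8.Eq1.91 / B8.Claim@92 heads
NOT changed (owner's word).  NOT summit progress, NOT continuum, NOT Clay.
-/

namespace Literature.MathematicalPhysics.QuantumFieldTheory.Balaban1983to89.B8Ineq192MultiLevelTorusP23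

open Matrix
open B4Reflection242 (boxDom)
open B6MultiLevelBoxOperator
open B6MultiLevelTorusOperator
open B6Geom246MultiLevelBox
open B6Geom246MultiLevelTorus
open B6Ineq268MultiLevelBox
open B6RandomWalk (HasMajorant)
open B6Ineq243TwoLevelBox (aNext)
open B6Expansion282 (kerOp)
open B6Prop23Chain (mat)
open B6Prop22DerivMultiLevelTorus (dT)
open B6Prop23MultiLevelTorus (GinvT prop23_multiLevelTorus)
open B8Ineq192MultiLevelTorus
open B8Ineq192MultiLevelTorusP22 (hKer_decay_T_P22 ineq192_multiLevelTorus_P22 rProjMLT_sup_bound_P22)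
open B8Ineq198MultiLevelTorusP22 (prop22_entries1236_multiLevelTorus)

noncomputable section

variable {d : ℕ}

/-- **THE KERNEL OF (1.91) AT U₀ = 1 ON THE `k`-LEVEL TORUS FAMILY DECAYS, WITH THE GENUINE LEVEL PREFACTORS — HYPOTHESIS-FREE**:
there are `ρ, B, M₀ > 0`, `N₀ ≥ 1` (functions of `d, ℓ` and the weight windows) such that for every `k`, `M_h ≥ 3` with
`L·M_h ≥ M₀`, `R ≥ 2L` with `R·L·M_h ≥ N₀ + 1`, periods `P_μ ≥ 4`, every nested torus family `D` with (2.1)–(2.2) and every windowed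
weight sequence: `(Q′G′²Q′*)⁻¹ = GinvT D a` is THE two-sided inverse (`GinvT·(Q′G′²Q′*) = 1 = (Q′G′²Q′*)·GinvT`) and
`H′ = G′²Q′*(Q′G′²Q′*)⁻¹` (`hPrimeMLT D a (GinvT D a)`) satisfies, at every point `x` (level `j = D.lev x`) and every block `y′`,
`|(H′δ_{y′})(x)| ≦ Be^{−ρd_T(y(x),y′)}`, `|(∇_μH′δ_{y′})(x)| ≦ B(Lʲ)⁻¹e^{−ρd_T}` (every axis), `|((−Δ_T)H′δ_{y′})(x)| ≦ B(Lʲ)⁻²e^{−ρd_T}`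
— `B8Ineq192MultiLevelTorus.hPrime_single_decay_T` with its three Prop.-2.2 hypotheses discharged by
`prop22_entries1236_multiLevelTorus` and its `G`-hypothesis by `prop23_multiLevelTorus`.
[cite: Balaban1985RegularSpaces, (1.91)–(1.92) pp.91–92, p.93 l.1–4; Balaban1984PropagatorsII, Prop. 2.3 (2.87) p.238, Prop. 2.2 (2.67) p.234, p.235, p.224 (Ω₁ = T_η admitted)] -/
theorem hPrime_single_decay_T_P23 (d ℓ : ℕ) (hℓ : 1 ≤ ℓ) (aminus aplus a2minus a2plus : ℝ) (ha : 0 < aminus)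
    (ha2 : 0 < a2minus) :
    ∃ ρ B M₀ : ℝ, ∃ N₀ : ℕ, 0 < ρ ∧ 0 < B ∧ 0 < M₀ ∧ 0 < N₀ ∧
      ∀ (k Mh R : ℕ), 3 ≤ Mh → M₀ ≤ ((ℓ : ℝ) + 1) * Mh → 2 * (ℓ + 1) ≤ R → N₀ + 1 ≤ R * ((ℓ + 1) * Mh) →
      ∀ (P : Fin (d + 1) → ℕ) (_hP : ∀ μ, 1 ≤ P μ) (_hP4 : ∀ μ, 4 ≤ P μ) (D : TDomains d ℓ Mh k P R) (a c : ℕ → ℝ),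
        (∀ i, 1 ≤ i → aminus ≤ a i ∧ a i ≤ aplus) → (∀ i, 1 ≤ i → a2minus ≤ c i ∧ c i ≤ a2plus) →
        (∀ i, 1 ≤ i → a (i + 1) = aNext ℓ (a i) (c i)) →
        GinvT D a * kerOp (W D.toDomains) (XkT D a) = 1 ∧ kerOp (W D.toDomains) (XkT D a) * GinvT D a = 1 ∧
        ∀ (x : ↥(boxDom (N0 ℓ Mh k P))) (y' : ↥(bset D.toDomains)),
          |hPrimeMLT D a (GinvT D a) (Pi.single y' 1) x| ≤
            B * Real.exp (-(ρ * (geomT D).dist (blkOf D.toDomains x) y')) ∧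
          (∀ μ : Fin (d + 1), |(dT (N0 ℓ Mh k P) μ *ᵥ hPrimeMLT D a (GinvT D a) (Pi.single y' 1)) x| ≤
            B * (((ℓ : ℝ) + 1) ^ D.lev x.1)⁻¹ * Real.exp (-(ρ * (geomT D).dist (blkOf D.toDomains x) y'))) ∧
          |(perLapT (N0 ℓ Mh k P) *ᵥ hPrimeMLT D a (GinvT D a) (Pi.single y' 1)) x| ≤
            B * ((((ℓ : ℝ) + 1) ^ D.lev x.1) ^ 2)⁻¹ * Real.exp (-(ρ * (geomT D).dist (blkOf D.toDomains x) y')) := by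
  obtain ⟨δ₁, C₁, M₁, hδ₁, hC₁, hM₁, hP23⟩ := prop23_multiLevelTorus d ℓ hℓ aminus aplus a2minus a2plus ha ha2
  obtain ⟨δ₀, C, M₀, N₀, hδ₀, hC, hM₀, hN₀, hE⟩ :=
    prop22_entries1236_multiLevelTorus d ℓ hℓ aminus aplus a2minus a2plus ha ha2
  obtain ⟨ρ, B, N₁, hρ, hB, hN₁, hmain⟩ := hPrime_single_decay_T d ℓ hC hδ₀ hC₁ hδ₁
  refine ⟨ρ, B, max M₀ M₁, max N₀ N₁, hρ, hB, lt_max_of_lt_left hM₀, lt_max_of_lt_left hN₀, ?_⟩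
  intro k Mh R hMh hM hRL hRM P hP hP4 D a c haw hcw hac
  have hMh1 : 1 ≤ Mh := le_trans (by norm_num) hMh
  have hM0 : M₀ ≤ ((ℓ : ℝ) + 1) * Mh := (le_max_left _ _).trans hM
  have hM1 : M₁ ≤ ((ℓ : ℝ) + 1) * Mh := (le_max_right _ _).trans hM
  have hRM0 : N₀ + 1 ≤ R * ((ℓ + 1) * Mh) := le_trans (Nat.succ_le_succ (le_max_left _ _)) hRM
  have hRM1 : N₁ + 1 ≤ R * ((ℓ + 1) * Mh) := le_trans (Nat.succ_le_succ (le_max_right _ _)) hRM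
  obtain ⟨h1, h2, -, hG⟩ := hP23 k Mh R hM1 hRL P hP hP4 D a c haw hcw hac
  obtain ⟨hTG, hTD, -, hTL⟩ := hE k Mh R hMh hM0 hRL hRM0 P hP hP4 D a c haw hcw hac
  exact ⟨h1, h2, hmain k Mh R hMh1 hRM1 P hP D a (fun μ => dT (N0 ℓ Mh k P) μ) (perLapT (N0 ℓ Mh k P)) hTG hTD hTL
    (GinvT D a) hG⟩

/-- **THE (2.69)-KERNEL OF (1.91) ON THE TORUS DECAYS — HYPOTHESIS-FREE**: `|(H′δ_{y′})(x)| ≦ Be^{−ρd_T(y(x),y′)}` and, in the (2.69)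
convention of p. 92's display, `|H′(x, y′)| ≦ B(L^{j′})^{−(d+1)}e^{−ρd_T(y(x),y′)}` (`hKerT`), for `H′ = G′²Q′*(Q′G′²Q′*)⁻¹` with the
GENUINE torus `G′ = gmlT` and THE inverse `GinvT D a`, on every member of the family in print's regime
(`B8Ineq192MultiLevelTorusP22.hKer_decay_T_P22` with its `G`-hypothesis discharged by `prop23_multiLevelTorus`).
[cite: Balaban1985RegularSpaces, (1.91) p.91, p.92 (the display after (1.92)); Balaban1984PropagatorsII, Prop. 2.3 (2.87) p.238, (2.69) p.235, p.224] -/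
theorem hKer_decay_T_P23 (d ℓ : ℕ) (hℓ : 1 ≤ ℓ) (aminus aplus a2minus a2plus : ℝ) (ha : 0 < aminus)
    (ha2 : 0 < a2minus) :
    ∃ ρ B M₀ : ℝ, ∃ N₀ : ℕ, 0 < ρ ∧ 0 < B ∧ 0 < M₀ ∧ 0 < N₀ ∧
      ∀ (k Mh R : ℕ), 3 ≤ Mh → M₀ ≤ ((ℓ : ℝ) + 1) * Mh → 2 * (ℓ + 1) ≤ R → N₀ + 1 ≤ R * ((ℓ + 1) * Mh) →
      ∀ (P : Fin (d + 1) → ℕ) (_hP : ∀ μ, 1 ≤ P μ) (_hP4 : ∀ μ, 4 ≤ P μ) (D : TDomains d ℓ Mh k P R) (a c : ℕ → ℝ),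
        (∀ i, 1 ≤ i → aminus ≤ a i ∧ a i ≤ aplus) → (∀ i, 1 ≤ i → a2minus ≤ c i ∧ c i ≤ a2plus) →
        (∀ i, 1 ≤ i → a (i + 1) = aNext ℓ (a i) (c i)) →
        GinvT D a * kerOp (W D.toDomains) (XkT D a) = 1 ∧ kerOp (W D.toDomains) (XkT D a) * GinvT D a = 1 ∧
        ∀ (x : ↥(boxDom (N0 ℓ Mh k P))) (y' : ↥(bset D.toDomains)),
          |hPrimeMLT D a (GinvT D a) (Pi.single y' 1) x| ≤
            B * Real.exp (-(ρ * (geomT D).dist (blkOf D.toDomains x) y')) ∧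
          |hKerT D a (GinvT D a) x y'| ≤
            B * (W D.toDomains y')⁻¹ * Real.exp (-(ρ * (geomT D).dist (blkOf D.toDomains x) y')) := by
  obtain ⟨δ₁, C₁, M₁, hδ₁, hC₁, hM₁, hP23⟩ := prop23_multiLevelTorus d ℓ hℓ aminus aplus a2minus a2plus ha ha2
  obtain ⟨ρ, B, M₀, N₀, hρ, hB, hM₀, hN₀, h⟩ := hKer_decay_T_P22 d ℓ hℓ aminus aplus a2minus a2plus ha ha2 hC₁ hδ₁
  refine ⟨ρ, B, max M₀ M₁, N₀, hρ, hB, lt_max_of_lt_left hM₀, hN₀, ?_⟩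
  intro k Mh R hMh hM hRL hRM P hP hP4 D a c haw hcw hac
  obtain ⟨h1, h2, -, hG⟩ := hP23 k Mh R ((le_max_right _ _).trans hM) hRL P hP hP4 D a c haw hcw hac
  exact ⟨h1, h2, h k Mh R hMh ((le_max_left _ _).trans hM) hRL hRM P hP hP4 D a c haw hcw hac (GinvT D a) hG⟩

/-- **(1.92) AND THE p. 93 Δ-ENTRY AT U₀ = 1 ON PRINT'S CARRIER `T_η` — HYPOTHESIS-FREE**: «|(H′X)(x)|, |(∇H′X)(x)| ≦
B′₀[1, (Lʲη)⁻¹]|X| for x ∈ Ω_j» and `|((−Δ_T)H′X)(x)| ≦ B′₀(Lʲ)⁻²|X|`, together with «Q′H′ = I», for print's own operator (1.91)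
`H′ = G′²Q′*(Q′G′²Q′*)⁻¹` (`hPrimeMLT D a (GinvT D a)`: the GENUINE `k`-level torus `G′ = Δ′_a⁻¹ = gmlT`, `Q′* = QsB`, THE inverse
`GinvT` of [B6] Prop. 2.3), `∇_μ = dT N₀ μ`, `−Δ_T = perLapT N₀`: there are `B′₀, M₀ > 0`, `N₀ ≥ 1` (functions of `d, ℓ` and the
windows) such that for every member of the family in print's regime, every `X : 𝔅 → ℝ` with `|X(y′)| ≦ S` and every point `x` at its
level `j`: `Q′(H′X) = X`, `|(H′X)(x)| ≦ B′₀S`, `|(∇_μH′X)(x)| ≦ B′₀(Lʲ)⁻¹S`, `|((−Δ_T)H′X)(x)| ≦ B′₀(Lʲ)⁻²S` —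
`B8Ineq192MultiLevelTorusP22.ineq192_multiLevelTorus_P22` ∘ `prop23_multiLevelTorus`, «Q′H′ = I» by `QB_hPrimeMLT`.
[cite: Balaban1985RegularSpaces, (1.91)–(1.92) pp.91–92, p.93 l.1–4, (1.115)–(1.116) p.96; Balaban1984PropagatorsII, Prop. 2.3 (2.87) p.238, Prop. 2.2 (2.67) p.234, p.235, p.224] -/
theorem ineq192_multiLevelTorus_P23 (d ℓ : ℕ) (hℓ : 1 ≤ ℓ) (aminus aplus a2minus a2plus : ℝ) (ha : 0 < aminus)
    (ha2 : 0 < a2minus) :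
    ∃ B₀' M₀ : ℝ, ∃ N₀ : ℕ, 0 < B₀' ∧ 0 < M₀ ∧ 0 < N₀ ∧
      ∀ (k Mh R : ℕ), 3 ≤ Mh → M₀ ≤ ((ℓ : ℝ) + 1) * Mh → 2 * (ℓ + 1) ≤ R → N₀ + 1 ≤ R * ((ℓ + 1) * Mh) →
      ∀ (P : Fin (d + 1) → ℕ) (_hP : ∀ μ, 1 ≤ P μ) (_hP4 : ∀ μ, 4 ≤ P μ) (D : TDomains d ℓ Mh k P R) (a c : ℕ → ℝ),
        (∀ i, 1 ≤ i → aminus ≤ a i ∧ a i ≤ aplus) → (∀ i, 1 ≤ i → a2minus ≤ c i ∧ c i ≤ a2plus) →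
        (∀ i, 1 ≤ i → a (i + 1) = aNext ℓ (a i) (c i)) →
        GinvT D a * kerOp (W D.toDomains) (XkT D a) = 1 ∧ kerOp (W D.toDomains) (XkT D a) * GinvT D a = 1 ∧
        (∀ X : ↥(bset D.toDomains) → ℝ, QB D.toDomains (hPrimeMLT D a (GinvT D a) X) = X) ∧
        ∀ (X : ↥(bset D.toDomains) → ℝ) (S : ℝ), 0 ≤ S → (∀ y', |X y'| ≤ S) →
          ∀ x : ↥(boxDom (N0 ℓ Mh k P)),
            |hPrimeMLT D a (GinvT D a) X x| ≤ B₀' * S ∧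
            (∀ μ : Fin (d + 1), |(dT (N0 ℓ Mh k P) μ *ᵥ hPrimeMLT D a (GinvT D a) X) x| ≤
              B₀' * (((ℓ : ℝ) + 1) ^ D.lev x.1)⁻¹ * S) ∧
            |(perLapT (N0 ℓ Mh k P) *ᵥ hPrimeMLT D a (GinvT D a) X) x| ≤
              B₀' * ((((ℓ : ℝ) + 1) ^ D.lev x.1) ^ 2)⁻¹ * S := by
  obtain ⟨δ₁, C₁, M₁, hδ₁, hC₁, hM₁, hP23⟩ := prop23_multiLevelTorus d ℓ hℓ aminus aplus a2minus a2plus ha ha2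
  obtain ⟨B₀', M₀, N₀, hB, hM₀, hN₀, h⟩ := ineq192_multiLevelTorus_P22 d ℓ hℓ aminus aplus a2minus a2plus ha ha2 hC₁ hδ₁
  refine ⟨B₀', max M₀ M₁, N₀, hB, lt_max_of_lt_left hM₀, hN₀, ?_⟩
  intro k Mh R hMh hM hRL hRM P hP hP4 D a c haw hcw hac
  obtain ⟨h1, h2, -, hG⟩ := hP23 k Mh R ((le_max_right _ _).trans hM) hRL P hP hP4 D a c haw hcw hac
  exact ⟨h1, h2, fun X => QB_hPrimeMLT h2 X,
    h k Mh R hMh ((le_max_left _ _).trans hM) hRL hRM P hP hP4 D a c haw hcw hac (GinvT D a) hG⟩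

/-- **«|Rf| ≦ B′₀|f|» (p. 92) AT U₀ = 1 ON PRINT'S CARRIER `T_η` — HYPOTHESIS-FREE**, for print's own gauge-fixing projection
`R = 1 − G′Q′*(Q′G′²Q′*)⁻¹Q′G′` of (1.27) / [4] (3.25) (`rProjMLT D a (GinvT D a)`, THE inverse of [B6] Prop. 2.3 inside), together
with its projection identities `Q′G′R = 0`, `R·G′Q′* = 0`, `R² = R`: there are `B′₀, M₀ > 0`, `N₀ ≥ 1` such that for every member of
the torus family in print's regime, every fine `f` with `|f(z)| ≦ S` and every point `x`: `|(Rf)(x)| ≦ B′₀S` —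
`B8Ineq192MultiLevelTorusP22.rProjMLT_sup_bound_P22` ∘ `prop23_multiLevelTorus`; identities by `QB_gmlT_rProjMLT`, `rProjMLT_gmlT_QsB`,
`rProjMLT_idem`. [cite: Balaban1985RegularSpaces, p.92, (1.27) p.80; Balaban1985BackgroundPropagators, (3.25) p.394; Balaban1984PropagatorsII, Prop. 2.3 (2.87) p.238, p.235, p.224; Balaban1984PropagatorsI, p.25] -/
theorem rProjMLT_sup_bound_P23 (d ℓ : ℕ) (hℓ : 1 ≤ ℓ) (aminus aplus a2minus a2plus : ℝ) (ha : 0 < aminus)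
    (ha2 : 0 < a2minus) :
    ∃ B₀' M₀ : ℝ, ∃ N₀ : ℕ, 0 < B₀' ∧ 0 < M₀ ∧ 0 < N₀ ∧
      ∀ (k Mh R : ℕ), 3 ≤ Mh → M₀ ≤ ((ℓ : ℝ) + 1) * Mh → 2 * (ℓ + 1) ≤ R → N₀ + 1 ≤ R * ((ℓ + 1) * Mh) →
      ∀ (P : Fin (d + 1) → ℕ) (_hP : ∀ μ, 1 ≤ P μ) (_hP4 : ∀ μ, 4 ≤ P μ) (D : TDomains d ℓ Mh k P R) (a c : ℕ → ℝ),
        (∀ i, 1 ≤ i → aminus ≤ a i ∧ a i ≤ aplus) → (∀ i, 1 ≤ i → a2minus ≤ c i ∧ c i ≤ a2plus) →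
        (∀ i, 1 ≤ i → a (i + 1) = aNext ℓ (a i) (c i)) →
        GinvT D a * kerOp (W D.toDomains) (XkT D a) = 1 ∧ kerOp (W D.toDomains) (XkT D a) * GinvT D a = 1 ∧
        (∀ f, QB D.toDomains (gmlT (N0 ℓ Mh k P) ℓ k D.lev a *ᵥ rProjMLT D a (GinvT D a) f) = 0) ∧
        (∀ Xc, rProjMLT D a (GinvT D a) (gmlT (N0 ℓ Mh k P) ℓ k D.lev a *ᵥ QsB D.toDomains Xc) = 0) ∧
        (∀ f, rProjMLT D a (GinvT D a) (rProjMLT D a (GinvT D a) f) = rProjMLT D a (GinvT D a) f) ∧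
        ∀ (f : ↥(boxDom (N0 ℓ Mh k P)) → ℝ) (S : ℝ), 0 ≤ S → (∀ z, |f z| ≤ S) →
          ∀ x : ↥(boxDom (N0 ℓ Mh k P)), |rProjMLT D a (GinvT D a) f x| ≤ B₀' * S := by
  obtain ⟨δ₁, C₁, M₁, hδ₁, hC₁, hM₁, hP23⟩ := prop23_multiLevelTorus d ℓ hℓ aminus aplus a2minus a2plus ha ha2
  obtain ⟨B₀', M₀, N₀, hB, hM₀, hN₀, h⟩ := rProjMLT_sup_bound_P22 d ℓ hℓ aminus aplus a2minus a2plus ha ha2 hC₁ hδ₁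
  refine ⟨B₀', max M₀ M₁, N₀, hB, lt_max_of_lt_left hM₀, hN₀, ?_⟩
  intro k Mh R hMh hM hRL hRM P hP hP4 D a c haw hcw hac
  obtain ⟨h1, h2, -, hG⟩ := hP23 k Mh R ((le_max_right _ _).trans hM) hRL P hP hP4 D a c haw hcw hac
  exact ⟨h1, h2, fun f => QB_gmlT_rProjMLT h2 f, fun Xc => rProjMLT_gmlT_QsB h1 Xc, fun f => rProjMLT_idem h2 f,
    h k Mh R hMh ((le_max_left _ _).trans hM) hRL hRM P hP hP4 D a c haw hcw hac (GinvT D a) hG⟩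

end

end Literature.MathematicalPhysics.QuantumFieldTheory.Balaban1983to89.B8Ineq192MultiLevelTorusP23
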